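import Summits.AtomisticToContinuum.HydrodynamicLimit.Theorems.JParityClosureParityBandClosureStressIsotropyOfWindowCovarianceF
import HarnessLib

/-!
# Window-to-cone step of `ParityBandClosure` — helper G: freezing the weight on one window

Support file for the stub `stub_stressIsotropyOfWindowCovariance` of the line `transfer-weighted-parity-chain`
(skeleton v4) of the crux `JParityClosure.ParityBandClosure` (stmt-AtomisticToContinuum-17608).

WHAT.  `window_estimate` — the COMPLETE deterministic estimate of one full window `(t₀, x)` of a measurable curve
of configurations with `ke ≤ K`: the tent-windowed same-time functional
`V(t₀, x) = ∫ bt(s − t₀) g(σ³ρ_r(s,x)) Σ aⱼₖ(s,x) Pⱼₖ(s,x) ds` of `WeakStressIsotropyInBand` is bounded by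
`|g(σ³ρ_w)| A dev + Gb 3A (4VΔm + 4V²Δρ + 6T̄ + 4T₀) + 30(Gb κ_a + A κ_g) ē + (Gb A σ³ R/λ)(60V² Δρ + 30 T̄)`:
the weight `g(σ³ρ_r(s)) aⱼₖ(s)` is frozen at the window values `g(σ³ρ_w) aⱼₖ(t₀)` at the price of the time modulus
`κ_a` of `a` on the window, the modulus `(κ_g, λ)` of `g` on `[0, ∞)` in its "always" form
`|g b − g b'| ≤ κ_g + (2Gb/λ)|b − b'|`, the cap `ρ_r ≤ R` on the window and `Σ|Pⱼₖ| ≤ 30 e_r ≤ 15 V² ρ_r + 15 T`; the frozen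
term is helper F's `window_main_le`.  Here `ē = ∫ bt e_r`, and `Δm, Δρ, T̄, T₀, dev` are as in helper F.

REFERENCES.  Deterministic bookkeeping; helpers A–F of this stub.
-/

noncomputable section

namespace Summit.AtomisticToContinuum.HydrodynamicLimit.Theorems.ParityBandClosureWindowToCone

open scoped BigOperators Topology Classical MeasureTheory ENNReal InnerProductSpace
open Filter Set MeasureTheory Function
open Literature.MathematicalPhysics.KineticTheory
open Literature.Analysis.FluidPDE
open Literature.Analysis.FunctionSpaces
open Summit.AtomisticToContinuum.HydrodynamicLimit.Theorems.LocalSecondLawNegative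
open Summit.AtomisticToContinuum.HydrodynamicLimit.Theorems.LocalSecondLawLedger
open Summit.AtomisticToContinuum.HydrodynamicLimit.Theorems.LocalSecondLawLedger.L
  (Mmom rhoC_eq_sum momC_apply_eq_sum momC_eq_sum norm_sq_eq_sum)
open Summit.AtomisticToContinuum.HydrodynamicLimit.Theorems.ChaosClosesEulerReduction
open Summit.AtomisticToContinuum.HydrodynamicLimit.Theorems.ChaosClosesEulerStressIsotropy
open Summit.AtomisticToContinuum.HydrodynamicLimit.Theorems.ChaosClosesEulerWindowedInvariance (tent_nonneg_le cone_nonneg_le)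
open Summit.AtomisticToContinuum.HydrodynamicLimit.Theorems.ChaosClosesEulerPressureValue (tent_eq_zero_of_le abs_lt_of_tent_ne_zero)

variable {N : ℕ}

/-! ## §1 Small tools -/

/-- **The "always" form of a modulus of continuity**: if `|g| ≤ Gb` on `[0, ∞)` and `|g b − g b'| ≤ κ` whenever
`b, b' ≥ 0`, `|b − b'| < λ`, then `|g b − g b'| ≤ κ + (2Gb/λ)|b − b'|` for ALL `b, b' ≥ 0` (`κ ≥ 0`, `λ > 0`). [folklore] -/
theorem abs_sub_le_modulus_always {g : ℝ → ℝ} {Gb κ lam : ℝ} (hGb : ∀ b, 0 ≤ b → |g b| ≤ Gb) (hκ : 0 ≤ κ)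
    (hlam : 0 < lam) (hmod : ∀ b b', 0 ≤ b → 0 ≤ b' → |b - b'| < lam → |g b - g b'| ≤ κ) {b b' : ℝ} (hb : 0 ≤ b)
    (hb' : 0 ≤ b') : |g b - g b'| ≤ κ + 2 * Gb / lam * |b - b'| := by
  have hGb0 : 0 ≤ Gb := (abs_nonneg _).trans (hGb 0 le_rfl)
  by_cases h : |b - b'| < lam
  · have := hmod b b' hb hb' h
    have : 0 ≤ 2 * Gb / lam * |b - b'| := by positivity
    linarith
  · rw [not_lt] at h
    have h1 : |g b - g b'| ≤ 2 * Gb := (abs_sub _ _).trans (by linarith [hGb b hb, hGb b' hb'])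
    have h2 : 2 * Gb ≤ 2 * Gb / lam * |b - b'| := by
      rw [div_mul_eq_mul_div, le_div_iff₀ hlam]
      exact mul_le_mul_of_nonneg_left h (by positivity)
    linarith

/-- `Σⱼₖ |Pⱼₖ| ≤ 30 e_r` with the central tensor written through `MpsiC`. [folklore] -/
theorem sum_abs_P_le {r : ℝ} (hr : 0 < r) (w : Phase N) (x : T3) :
    ∑ j : Fin 3, ∑ k : Fin 3, |MpsiC r w x (fun v => v j * v k) - momC r w x j * momC r w x k / rhoC r w x| ≤
      30 * kinC r w x := by
  have h := sum_abs_Pm_le hr w x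
  simpa only [Mmom_eq_MpsiC] using h

/-- `|Pⱼₖ| ≤ (10/3) e_r` with the central tensor written through `MpsiC`. [folklore] -/
theorem abs_P_le {r : ℝ} (hr : 0 < r) (w : Phase N) (x : T3) (j k : Fin 3) :
    |MpsiC r w x (fun v => v j * v k) - momC r w x j * momC r w x k / rhoC r w x| ≤ 10 / 3 * kinC r w x := by
  have h := abs_Pm_le_kinC hr w x j k
  simpa only [Mmom_eq_MpsiC] using h

/-- **Energy against a density increment**: `e_r d ≤ (V²/2) R d + (R/2) T` whenever `ρ_r ≤ R`, `0 ≤ d ≤ R`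
(`T = MpsiC (sqTail V)`). [folklore] -/
theorem kinC_mul_le {r : ℝ} (hr : 0 < r) (w : Phase N) (x : T3) (V : ℝ) {R d : ℝ} (hρR : rhoC r w x ≤ R) (hd0 : 0 ≤ d)
    (hdR : d ≤ R) :
    kinC r w x * d ≤ V ^ 2 / 2 * R * d + R / 2 * MpsiC r w x (sqTail V) := by
  have h1 := kinC_le_add_tail hr w x V
  have hT := (MpsiC_sqTail_le hr w x V).1
  have hρ := rhoC_nonneg hr w x
  calc kinC r w x * d ≤ (V ^ 2 / 2 * rhoC r w x + MpsiC r w x (sqTail V) / 2) * d := mul_le_mul_of_nonneg_right h1 hd0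
    _ = V ^ 2 / 2 * (rhoC r w x * d) + MpsiC r w x (sqTail V) / 2 * d := by ring
    _ ≤ V ^ 2 / 2 * (R * d) + MpsiC r w x (sqTail V) / 2 * R := by
        gcongr
    _ = V ^ 2 / 2 * R * d + R / 2 * MpsiC r w x (sqTail V) := by ring

/-! ## §2 The complete estimate of one window -/

/-- **THE COMPLETE ESTIMATE OF ONE FULL WINDOW** (see the module docstring). [folklore] -/
theorem window_estimate {γ : ℝ → Phase N} (hγ : Measurable γ) {K : ℝ} (hK : ∀ s, ke (γ s) ≤ K)
    {r : ℝ} (hr : 0 < r) (hr2 : r < 1 / 2) {τ t₀ : ℝ} (ht₀ : r ^ 2 ≤ t₀) (ht₀τ : t₀ + r ^ 2 ≤ τ) (x : T3)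
    {V : ℝ} (hV : 0 < V) {σ : ℝ} (hσ : 0 ≤ σ)
    (a : Fin 3 → Fin 3 → ℝ × T3 → ℝ) (hac : ∀ j k, Continuous (a j k)) (htr : ∑ j, a j j (t₀, x) = 0)
    {A : ℝ} (hA : ∀ j k, ∀ s ∈ Icc 0 τ, |a j k (s, x)| ≤ A)
    {κa : ℝ} (hκa : ∀ j k, ∀ s ∈ Icc 0 τ, |s - t₀| ≤ r ^ 2 → |a j k (s, x) - a j k (t₀, x)| ≤ κa)
    (g : ℝ → ℝ) (hgc : Continuous g) {Gb : ℝ} (hGb : ∀ b, 0 ≤ b → |g b| ≤ Gb)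
    {κg lam : ℝ} (hlam : 0 < lam) (hκg0 : 0 ≤ κg) (hκg : ∀ b b', 0 ≤ b → 0 ≤ b' → |b - b'| < lam → |g b - g b'| ≤ κg)
    {Rcap : ℝ} (hcap : ∀ s ∈ Icc 0 τ, rhoC r (γ s) x ≤ Rcap) :
    |∫ s in Icc 0 τ, (r ^ 2)⁻¹ * max (1 - |s - t₀| / r ^ 2) 0 * (g (σ ^ 3 * rhoC r (γ s) x) *
        ∑ j, ∑ k, a j k (s, x) *
          (MpsiC r (γ s) x (fun v => v j * v k) - momC r (γ s) x j * momC r (γ s) x k / rhoC r (γ s) x))| ≤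
      |g (σ ^ 3 * ∫ s in Icc 0 τ, (r ^ 2)⁻¹ * max (1 - |s - t₀| / r ^ 2) 0 * rhoC r (γ s) x)| *
          (A * ∑ j, ∑ k, |((∫ s in Icc 0 τ, (r ^ 2)⁻¹ * max (1 - |s - t₀| / r ^ 2) 0 * MpsiC r (γ s) x (fun v => v j * v k)) -
            (∫ s in Icc 0 τ, (r ^ 2)⁻¹ * max (1 - |s - t₀| / r ^ 2) 0 * MpsiC r (γ s) x (fun v => v j)) *
            (∫ s in Icc 0 τ, (r ^ 2)⁻¹ * max (1 - |s - t₀| / r ^ 2) 0 * MpsiC r (γ s) x (fun v => v k)) /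
            (∫ s in Icc 0 τ, (r ^ 2)⁻¹ * max (1 - |s - t₀| / r ^ 2) 0 * rhoC r (γ s) x)) -
          if j = k then (∑ l, ((∫ s in Icc 0 τ, (r ^ 2)⁻¹ * max (1 - |s - t₀| / r ^ 2) 0 * MpsiC r (γ s) x (fun v => v l * v l)) -
            (∫ s in Icc 0 τ, (r ^ 2)⁻¹ * max (1 - |s - t₀| / r ^ 2) 0 * MpsiC r (γ s) x (fun v => v l)) *
            (∫ s in Icc 0 τ, (r ^ 2)⁻¹ * max (1 - |s - t₀| / r ^ 2) 0 * MpsiC r (γ s) x (fun v => v l)) /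
            (∫ s in Icc 0 τ, (r ^ 2)⁻¹ * max (1 - |s - t₀| / r ^ 2) 0 * rhoC r (γ s) x))) / 3 else 0|) +
      Gb * (3 * A * (4 * V * (∫ s in Icc 0 τ, (r ^ 2)⁻¹ * max (1 - |s - t₀| / r ^ 2) 0 * ‖momC r (γ s) x - momC r (γ t₀) x‖) +
          4 * V ^ 2 * (∫ s in Icc 0 τ, (r ^ 2)⁻¹ * max (1 - |s - t₀| / r ^ 2) 0 * |rhoC r (γ s) x - rhoC r (γ t₀) x|) +
          6 * (∫ s in Icc 0 τ, (r ^ 2)⁻¹ * max (1 - |s - t₀| / r ^ 2) 0 * MpsiC r (γ s) x (sqTail V)) +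
          4 * MpsiC r (γ t₀) x (sqTail V))) +
      30 * (Gb * κa + A * κg) * (∫ s in Icc 0 τ, (r ^ 2)⁻¹ * max (1 - |s - t₀| / r ^ 2) 0 * kinC r (γ s) x) +
      Gb * A * σ ^ 3 * Rcap / lam *
        (60 * V ^ 2 * (∫ s in Icc 0 τ, (r ^ 2)⁻¹ * max (1 - |s - t₀| / r ^ 2) 0 * |rhoC r (γ s) x - rhoC r (γ t₀) x|) +
          30 * (∫ s in Icc 0 τ, (r ^ 2)⁻¹ * max (1 - |s - t₀| / r ^ 2) 0 * MpsiC r (γ s) x (sqTail V))) := by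
  have hh : 0 < r ^ 2 := by positivity
  have hC : 0 ≤ 3 / (Real.pi * r ^ 3) := by positivity
  have hGb0 : 0 ≤ Gb := (abs_nonneg _).trans (hGb 0 le_rfl)
  have ht₀mem : t₀ ∈ Icc 0 τ := ⟨by linarith, by linarith⟩
  have hA0 : 0 ≤ A := (abs_nonneg _).trans (hA 0 0 t₀ ht₀mem)
  -- abbreviations
  set w : ℝ → ℝ := fun s => (r ^ 2)⁻¹ * max (1 - |s - t₀| / r ^ 2) 0 with hwdef
  have hw0 : ∀ s, 0 ≤ w s := fun s => (tent_nonneg_le hh _).1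
  have hwle : ∀ s, w s ≤ (r ^ 2)⁻¹ := fun s => (tent_nonneg_le hh _).2
  set ρ : ℝ → ℝ := fun s => rhoC r (γ s) x with hρdef
  set e : ℝ → ℝ := fun s => kinC r (γ s) x with hedef
  set T : ℝ → ℝ := fun s => MpsiC r (γ s) x (sqTail V) with hTdef
  set P : Fin 3 → Fin 3 → ℝ → ℝ := fun j k s =>
    MpsiC r (γ s) x (fun v => v j * v k) - momC r (γ s) x j * momC r (γ s) x k / rhoC r (γ s) x with hPdef
  set ρw : ℝ := ∫ s in Icc 0 τ, w s * ρ s with hρwdef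
  set μ : Measure ℝ := volume.restrict (Icc 0 τ) with hμ
  have hρ0 : ∀ s, 0 ≤ ρ s := fun s => rhoC_nonneg hr _ _
  have he0 : ∀ s, 0 ≤ e s := fun s => kinC_nonneg hr _ _
  have hT0 : ∀ s, 0 ≤ T s := fun s => (MpsiC_sqTail_le hr (γ s) x V).1
  have hRcap0 : 0 ≤ Rcap := (hρ0 t₀).trans (hcap t₀ ht₀mem)
  -- measurability and bounds
  have hρm : Measurable ρ := measurable_rhoC_curve hγ r x
  have hem : Measurable e := measurable_kinC_curve hγ r x
  have hTm : Measurable T := measurable_MpsiC_curve hγ r x (measurable_sqTail V)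
  have hmomm : Measurable fun s => momC r (γ s) x := measurable_momC_curve hγ r x
  have hPm : ∀ j k, Measurable (P j k) := by
    intro j k
    have h1 : Measurable fun s => MpsiC r (γ s) x (fun v => v j * v k) := measurable_MpsiC_curve hγ r x (by fun_prop)
    have h2 : ∀ i : Fin 3, Measurable fun s => momC r (γ s) x i := fun i =>
      (EuclideanSpace.proj i : V3 →L[ℝ] ℝ).continuous.measurable.comp hmomm
    exact h1.sub (((h2 j).mul (h2 k)).div hρm)
  have hρb : ∀ s, |ρ s| ≤ 3 / (Real.pi * r ^ 3) := fun s => by rw [abs_of_nonneg (hρ0 s)]; exact rhoC_le hr _ _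
  have heb : ∀ s, |e s| ≤ 3 / (Real.pi * r ^ 3) * K := fun s => by
    rw [abs_of_nonneg (he0 s)]
    exact (kinC_le_sup hr (γ s) x).2.trans (mul_le_mul_of_nonneg_left (hK s) hC)
  have hTb : ∀ s, |T s| ≤ 3 / (Real.pi * r ^ 3) * (2 * K) := fun s => by
    rw [abs_of_nonneg (hT0 s)]
    exact (MpsiC_sqTail_le hr (γ s) x V).2.trans (mul_le_mul_of_nonneg_left (by linarith [hK s]) hC)
  have hPb : ∀ j k s, |P j k s| ≤ 10 / 3 * (3 / (Real.pi * r ^ 3) * K) := fun j k s =>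
    (abs_P_le hr (γ s) x j k).trans (mul_le_mul_of_nonneg_left ((kinC_le_sup hr (γ s) x).2.trans
      (mul_le_mul_of_nonneg_left (hK s) hC)) (by norm_num))
  -- window mass and the window density
  have hmass : ∫ s, w s ∂μ = 1 := window_mass_eq_one hh (by linarith) ht₀τ
  have hIρ : Integrable (fun s => w s * ρ s) μ := integrableOn_tent_mul hr t₀ τ hρm hρb
  have hρw0 : 0 ≤ ρw := integral_nonneg fun s => mul_nonneg (hw0 s) (hρ0 s)
  have hρwR : ρw ≤ Rcap := by
    have h1 : ∫ s, w s * ρ s ∂μ ≤ ∫ s, w s * Rcap ∂μ := by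
      refine setIntegral_mono_on hIρ (((integrable_tent_sub' hh t₀).mul_const Rcap).integrableOn) measurableSet_Icc
        fun s hs => ?_
      exact mul_le_mul_of_nonneg_left (hcap s hs) (hw0 s)
    rw [integral_mul_const, hmass, one_mul] at h1
    exact h1
  have hdρR : ∀ s ∈ Icc 0 τ, |ρ s - ρw| ≤ Rcap := fun s hs => by
    rw [abs_le]; constructor <;> linarith [hρ0 s, hcap s hs]
  -- ### split the integrand: frozen part + freezing error
  set gw : ℝ := g (σ ^ 3 * ρw) with hgwdef
  set f : ℝ → ℝ := fun s => g (σ ^ 3 * ρ s) * ∑ j, ∑ k, a j k (s, x) * P j k s with hfdef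
  have hIwP : ∀ j k, Integrable (fun s => w s * P j k s) μ := fun j k => integrableOn_tent_mul hr t₀ τ (hPm j k) (hPb j k)
  have hsl : Continuous fun s : ℝ => ((s, x) : ℝ × T3) := continuous_id.prodMk continuous_const
  have hajk : ∀ j k, Measurable fun s : ℝ => a j k (s, x) := fun j k => by
    have h1 := Continuous.comp (hac j k) hsl
    exact h1.measurable
  have hfm : Measurable f := by
    refine (hgc.measurable.comp (hρm.const_mul _)).mul (Finset.measurable_sum _ fun j _ => Finset.measurable_sum _ fun k _ => ?_)
    exact (hajk j k).mul (hPm j k)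
  have hsumP : ∀ s, ∑ j, ∑ k, |P j k s| ≤ 30 * e s := fun s => sum_abs_P_le hr (γ s) x
  have hfb : ∀ s ∈ Icc 0 τ, |f s| ≤ Gb * (A * (30 * (3 / (Real.pi * r ^ 3) * K))) := by
    intro s hs
    simp only [hfdef]
    rw [abs_mul]
    refine mul_le_mul (hGb _ (mul_nonneg (pow_nonneg hσ 3) (hρ0 s))) ?_ (abs_nonneg _) hGb0
    calc |∑ j, ∑ k, a j k (s, x) * P j k s| ≤ ∑ j, ∑ k, A * |P j k s| := by
          refine (Finset.abs_sum_le_sum_abs _ _).trans (Finset.sum_le_sum fun j _ => ?_)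
          refine (Finset.abs_sum_le_sum_abs _ _).trans (Finset.sum_le_sum fun k _ => ?_)
          rw [abs_mul]; exact mul_le_mul_of_nonneg_right (hA j k s hs) (abs_nonneg _)
      _ = A * ∑ j, ∑ k, |P j k s| := by rw [Finset.mul_sum]; exact Finset.sum_congr rfl fun j _ => by rw [Finset.mul_sum]
      _ ≤ A * (30 * e s) := mul_le_mul_of_nonneg_left (hsumP s) hA0
      _ ≤ A * (30 * (3 / (Real.pi * r ^ 3) * K)) := by
          refine mul_le_mul_of_nonneg_left (mul_le_mul_of_nonneg_left ?_ (by norm_num)) hA0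
          exact (le_abs_self _).trans (heb s)
  -- the frozen integrand and the error integrand
  set fz : ℝ → ℝ := fun s => ∑ j, ∑ k, gw * a j k (t₀, x) * (w s * P j k s) with hfzdef
  set er : ℝ → ℝ := fun s => w s * ∑ j, ∑ k, (g (σ ^ 3 * ρ s) * a j k (s, x) - gw * a j k (t₀, x)) * P j k s with herdef
  have hsplit : ∀ s, w s * f s = fz s + er s := by
    intro s
    simp only [hfdef, hfzdef, herdef]
    rw [Finset.mul_sum, Finset.mul_sum, Finset.mul_sum, ← Finset.sum_add_distrib]
    refine Finset.sum_congr rfl fun j _ => ?_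
    rw [Finset.mul_sum, Finset.mul_sum, Finset.mul_sum, ← Finset.sum_add_distrib]
    refine Finset.sum_congr rfl fun k _ => ?_
    ring
  have hIfz : Integrable fz μ :=
    integrable_finsetSum _ fun j _ => integrable_finsetSum _ fun k _ => (hIwP j k).const_mul _
  have hIwf : Integrable (fun s => w s * f s) μ := by
    have hb : ∀ s, |f s| ≤ max (Gb * (A * (30 * (3 / (Real.pi * r ^ 3) * K)))) (|f s|) := fun s => le_max_right _ _
    -- bounded on `[0, τ]`, measurable: integrable on the finite window
    refine Measure.integrableOn_of_bounded (M := (r ^ 2)⁻¹ * (Gb * (A * (30 * (3 / (Real.pi * r ^ 3) * K)))))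
      (by rw [Real.volume_Icc]; exact ENNReal.ofReal_ne_top)
      (((by fun_prop : Measurable fun s : ℝ => (r ^ 2)⁻¹ * max (1 - |s - t₀| / r ^ 2) 0).mul hfm).aestronglyMeasurable) ?_
    refine (ae_restrict_iff' measurableSet_Icc).2 (ae_of_all _ fun s hs => ?_)
    rw [Real.norm_eq_abs, abs_mul, abs_of_nonneg (hw0 s)]
    exact mul_le_mul (hwle s) (hfb s hs) (abs_nonneg _) (by positivity)
  have hIer : Integrable er μ := by
    have e1 : er = fun s => w s * f s - fz s := funext fun s => by rw [hsplit s]; ring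
    rw [e1]; exact hIwf.sub hIfz
  have hdecomp : ∫ s, w s * f s ∂μ = (∫ s, fz s ∂μ) + ∫ s, er s ∂μ := by
    rw [← integral_add hIfz hIer]; exact integral_congr_ae (ae_of_all _ hsplit)
  -- ### the frozen part = helper F's main term
  have hfz_eq : ∫ s, fz s ∂μ = ∑ j, ∑ k, gw * a j k (t₀, x) * ∫ s, w s * P j k s ∂μ := by
    simp only [hfzdef]
    rw [integral_finsetSum _ fun j _ => integrable_finsetSum _ fun k _ => (hIwP j k).const_mul _]
    refine Finset.sum_congr rfl fun j _ => ?_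
    rw [integral_finsetSum _ fun k _ => (hIwP j k).const_mul _]
    refine Finset.sum_congr rfl fun k _ => ?_
    exact integral_const_mul _ _
  have hmain := window_main_le hγ hK hr hr2 ht₀ ht₀τ x hV (fun j k => a j k (t₀, x)) htr (fun j k => hA j k t₀ ht₀mem) gw
  have hgw : |gw| ≤ Gb := hGb _ (by positivity)
  -- ### the freezing error
  have hLip : ∀ s ∈ Icc 0 τ, w s ≠ 0 → ∀ j k, |g (σ ^ 3 * ρ s) * a j k (s, x) - gw * a j k (t₀, x)| ≤
      Gb * κa + A * (κg + 2 * Gb / lam * (σ ^ 3 * |ρ s - ρw|)) := by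
    intro s hs hws j k
    have hst : |s - t₀| < r ^ 2 := abs_lt_of_tent_ne_zero hh hws
    have e1 : g (σ ^ 3 * ρ s) * a j k (s, x) - gw * a j k (t₀, x) =
        g (σ ^ 3 * ρ s) * (a j k (s, x) - a j k (t₀, x)) + (g (σ ^ 3 * ρ s) - gw) * a j k (t₀, x) := by ring
    rw [e1]
    refine (abs_add_le _ _).trans (add_le_add ?_ ?_)
    · rw [abs_mul]
      exact mul_le_mul (hGb _ (mul_nonneg (pow_nonneg hσ 3) (hρ0 s))) (hκa j k s hs hst.le) (abs_nonneg _) hGb0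
    · rw [abs_mul, mul_comm]
      refine mul_le_mul (hA j k t₀ ht₀mem) ?_ (abs_nonneg _) hA0
      have h1 := abs_sub_le_modulus_always hGb hκg0 hlam hκg (b := σ ^ 3 * ρ s) (b' := σ ^ 3 * ρw)
        (mul_nonneg (pow_nonneg hσ 3) (hρ0 s)) (mul_nonneg (pow_nonneg hσ 3) hρw0)
      rw [← mul_sub, abs_mul, abs_of_nonneg (by positivity : (0 : ℝ) ≤ σ ^ 3)] at h1
      exact h1
  -- pointwise majorant of the error integrand on `[0, τ]`
  set G : ℝ → ℝ := fun s => 30 * (Gb * κa + A * κg) * (w s * e s) +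
    60 * Gb * A * σ ^ 3 / lam * (V ^ 2 / 2 * Rcap * (w s * |ρ s - ρw|) + Rcap / 2 * (w s * T s)) with hGdef
  have hpt : ∀ s ∈ Icc 0 τ, ‖er s‖ ≤ G s := by
    intro s hs
    rw [Real.norm_eq_abs]
    simp only [herdef, hGdef]
    by_cases hws : w s = 0
    · rw [hws]; simp
    · rw [abs_mul, abs_of_nonneg (hw0 s)]
      have hL := hLip s hs hws
      set L := Gb * κa + A * (κg + 2 * Gb / lam * (σ ^ 3 * |ρ s - ρw|)) with hLdef
      have h1 : |∑ j, ∑ k, (g (σ ^ 3 * ρ s) * a j k (s, x) - gw * a j k (t₀, x)) * P j k s| ≤ L * (30 * e s) := by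
        calc _ ≤ ∑ j, ∑ k, L * |P j k s| := by
              refine (Finset.abs_sum_le_sum_abs _ _).trans (Finset.sum_le_sum fun j _ => ?_)
              refine (Finset.abs_sum_le_sum_abs _ _).trans (Finset.sum_le_sum fun k _ => ?_)
              rw [abs_mul]; exact mul_le_mul_of_nonneg_right (hL j k) (abs_nonneg _)
          _ = L * ∑ j, ∑ k, |P j k s| := by rw [Finset.mul_sum]; exact Finset.sum_congr rfl fun j _ => by rw [Finset.mul_sum]
          _ ≤ L * (30 * e s) := mul_le_mul_of_nonneg_left (hsumP s) ((abs_nonneg _).trans (hL 0 0))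
      have h2 : e s * |ρ s - ρw| ≤ V ^ 2 / 2 * Rcap * |ρ s - ρw| + Rcap / 2 * T s :=
        kinC_mul_le hr (γ s) x V (hcap s hs) (abs_nonneg _) (hdρR s hs)
      have h3 : w s * (L * (30 * e s)) = 30 * (Gb * κa + A * κg) * (w s * e s) +
          60 * Gb * A * σ ^ 3 / lam * (w s * (e s * |ρ s - ρw|)) := by
        simp only [hLdef]; field_simp; ring
      have h4 : 0 ≤ 60 * Gb * A * σ ^ 3 / lam := by positivity
      calc w s * |∑ j, ∑ k, (g (σ ^ 3 * ρ s) * a j k (s, x) - gw * a j k (t₀, x)) * P j k s| ≤ w s * (L * (30 * e s)) :=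
            mul_le_mul_of_nonneg_left h1 (hw0 s)
        _ = _ := h3
        _ ≤ _ := by
            refine add_le_add le_rfl (mul_le_mul_of_nonneg_left ?_ h4)
            calc w s * (e s * |ρ s - ρw|) ≤ w s * (V ^ 2 / 2 * Rcap * |ρ s - ρw| + Rcap / 2 * T s) :=
                  mul_le_mul_of_nonneg_left h2 (hw0 s)
              _ = _ := by ring
  have hIwe : Integrable (fun s => w s * e s) μ := integrableOn_tent_mul hr t₀ τ hem heb
  have hIwT : Integrable (fun s => w s * T s) μ := integrableOn_tent_mul hr t₀ τ hTm hTb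
  have hdm : Measurable fun s => |ρ s - ρw| := (hρm.sub measurable_const).abs
  have hdb : ∀ s, |(|ρ s - ρw|)| ≤ 3 / (Real.pi * r ^ 3) + Rcap := fun s => by
    rw [abs_abs]; refine (abs_sub _ _).trans ?_; rw [abs_of_nonneg hρw0]; linarith [hρb s]
  have hIwd : Integrable (fun s => w s * |ρ s - ρw|) μ := integrableOn_tent_mul hr t₀ τ hdm hdb
  have hIG : Integrable G μ :=
    (hIwe.const_mul _).add (((hIwd.const_mul _).add (hIwT.const_mul _)).const_mul _)
  have herr : |∫ s, er s ∂μ| ≤ ∫ s, G s ∂μ := by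
    rw [← Real.norm_eq_abs]
    exact norm_integral_le_of_norm_le hIG ((ae_restrict_iff' measurableSet_Icc).2 (ae_of_all _ hpt))
  have hGint : ∫ s, G s ∂μ = 30 * (Gb * κa + A * κg) * (∫ s, w s * e s ∂μ) +
      60 * Gb * A * σ ^ 3 / lam * (V ^ 2 / 2 * Rcap * (∫ s, w s * |ρ s - ρw| ∂μ) + Rcap / 2 * ∫ s, w s * T s ∂μ) := by
    have i1 : Integrable (fun s => 30 * (Gb * κa + A * κg) * (w s * e s)) μ := hIwe.const_mul _
    have i3 : Integrable (fun s => V ^ 2 / 2 * Rcap * (w s * |ρ s - ρw|)) μ := hIwd.const_mul _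
    have i4 : Integrable (fun s => Rcap / 2 * (w s * T s)) μ := hIwT.const_mul _
    have i2 : Integrable (fun s => 60 * Gb * A * σ ^ 3 / lam * (V ^ 2 / 2 * Rcap * (w s * |ρ s - ρw|) + Rcap / 2 * (w s * T s))) μ :=
      (i3.add i4).const_mul _
    simp only [hGdef]
    rw [integral_add i1 i2, integral_const_mul, integral_const_mul, integral_add i3 i4, integral_const_mul, integral_const_mul]
  -- `∫ w |ρ − ρw| ≤ 2 Δρ`
  have hΔρb : ∀ s, |(|ρ s - ρ t₀|)| ≤ 2 * (3 / (Real.pi * r ^ 3)) := fun s => by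
    rw [abs_abs]; exact (abs_sub _ _).trans (by linarith [hρb s, hρb t₀])
  have hIΔρ : Integrable (fun s => w s * |ρ s - ρ t₀|) μ :=
    integrableOn_tent_mul hr t₀ τ ((hρm.sub measurable_const).abs) hΔρb
  have hcen : |ρ t₀ - ρw| ≤ ∫ s, w s * |ρ s - ρ t₀| ∂μ := by
    have e1 : ρ t₀ - ρw = ∫ s, w s * (ρ t₀ - ρ s) ∂μ := by
      have h1 : ∫ s, w s * (ρ t₀ - ρ s) ∂μ = (∫ s, w s * ρ t₀ ∂μ) - ∫ s, w s * ρ s ∂μ := by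
        rw [← integral_sub (((integrable_tent_sub' hh t₀).mul_const _).integrableOn) hIρ]
        exact integral_congr_ae (ae_of_all _ fun s => by ring)
      rw [h1, integral_mul_const, hmass, one_mul]
    rw [e1, ← Real.norm_eq_abs]
    refine (norm_integral_le_integral_norm _).trans (le_of_eq (integral_congr_ae (ae_of_all _ fun s => ?_)))
    show ‖w s * (ρ t₀ - ρ s)‖ = w s * |ρ s - ρ t₀|
    rw [Real.norm_eq_abs, abs_mul, abs_of_nonneg (hw0 s), abs_sub_comm]
  have hwd2 : ∫ s, w s * |ρ s - ρw| ∂μ ≤ 2 * ∫ s, w s * |ρ s - ρ t₀| ∂μ := by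
    have h1 : ∀ s, w s * |ρ s - ρw| ≤ w s * |ρ s - ρ t₀| + w s * |ρ t₀ - ρw| := fun s => by
      rw [← mul_add]; exact mul_le_mul_of_nonneg_left (abs_sub_le _ _ _) (hw0 s)
    calc ∫ s, w s * |ρ s - ρw| ∂μ ≤ ∫ s, (w s * |ρ s - ρ t₀| + w s * |ρ t₀ - ρw|) ∂μ :=
          integral_mono hIwd (hIΔρ.add (((integrable_tent_sub' hh t₀).mul_const _).integrableOn)) h1
      _ = (∫ s, w s * |ρ s - ρ t₀| ∂μ) + |ρ t₀ - ρw| := by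
          rw [integral_add hIΔρ (((integrable_tent_sub' hh t₀).mul_const _).integrableOn), integral_mul_const, hmass, one_mul]
      _ ≤ _ := by linarith [hcen]
  -- ### assemble
  have aux : ∀ {X Y : ℝ}, 0 ≤ Y → |gw| * (X + Y) ≤ |gw| * X + Gb * Y := fun hY => by
    rw [mul_add]; exact add_le_add le_rfl (mul_le_mul_of_nonneg_right hgw hY)
  have hΔm0 : 0 ≤ ∫ s in Icc 0 τ, w s * ‖momC r (γ s) x - momC r (γ t₀) x‖ :=
    integral_nonneg fun s => mul_nonneg (hw0 s) (norm_nonneg _)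
  have hΔρ0 : 0 ≤ ∫ s in Icc 0 τ, w s * |ρ s - ρ t₀| := integral_nonneg fun s => mul_nonneg (hw0 s) (abs_nonneg _)
  have hTbar0 : 0 ≤ ∫ s in Icc 0 τ, w s * T s := integral_nonneg fun s => mul_nonneg (hw0 s) (hT0 s)
  have h4V : (0 : ℝ) ≤ 4 * V := by positivity
  have h4V2 : (0 : ℝ) ≤ 4 * V ^ 2 := by positivity
  have hS0 : 0 ≤ 3 * A * (4 * V * (∫ s in Icc 0 τ, w s * ‖momC r (γ s) x - momC r (γ t₀) x‖) +
      4 * V ^ 2 * (∫ s in Icc 0 τ, w s * |ρ s - ρ t₀|) + 6 * (∫ s in Icc 0 τ, w s * T s) + 4 * T t₀) :=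
    mul_nonneg (mul_nonneg (by norm_num) hA0) (add_nonneg (add_nonneg (add_nonneg (mul_nonneg h4V hΔm0)
      (mul_nonneg h4V2 hΔρ0)) (mul_nonneg (by norm_num) hTbar0)) (mul_nonneg (by norm_num) (hT0 t₀)))
  have hmainG := hmain.trans (aux hS0)
  rw [← hfz_eq] at hmainG
  have hlast : 60 * Gb * A * σ ^ 3 / lam * (V ^ 2 / 2 * Rcap * (∫ s, w s * |ρ s - ρw| ∂μ) + Rcap / 2 * ∫ s, w s * T s ∂μ) ≤
      Gb * A * σ ^ 3 * Rcap / lam * (60 * V ^ 2 * (∫ s, w s * |ρ s - ρ t₀| ∂μ) + 30 * ∫ s, w s * T s ∂μ) := by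
    have h60 : 0 ≤ 60 * Gb * A * σ ^ 3 / lam := by positivity
    calc 60 * Gb * A * σ ^ 3 / lam * (V ^ 2 / 2 * Rcap * (∫ s, w s * |ρ s - ρw| ∂μ) + Rcap / 2 * ∫ s, w s * T s ∂μ)
        ≤ 60 * Gb * A * σ ^ 3 / lam * (V ^ 2 / 2 * Rcap * (2 * ∫ s, w s * |ρ s - ρ t₀| ∂μ) + Rcap / 2 * ∫ s, w s * T s ∂μ) :=
          mul_le_mul_of_nonneg_left (add_le_add (mul_le_mul_of_nonneg_left hwd2 (by positivity)) le_rfl) h60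
      _ = Gb * A * σ ^ 3 * Rcap / lam * (60 * V ^ 2 * (∫ s, w s * |ρ s - ρ t₀| ∂μ) + 30 * ∫ s, w s * T s ∂μ) := by
          field_simp
          ring
  have fin : ∀ {L P Q R S S' : ℝ}, L ≤ (P + Q) + (R + S) → S ≤ S' → L ≤ P + Q + R + S' := by
    intros; linarith
  have step : |∫ s, w s * f s ∂μ| ≤ _ + (_ + _) :=
    ((congrArg (fun y : ℝ => |y|) hdecomp).trans_le ((abs_add_le _ _).trans (add_le_add hmainG herr))).trans_eq
      (congrArg _ hGint)
  exact fin step hlast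

/-! ## §3 Registered sub-goal -/

/-- **Registered sub-goal `stub_stressIsotropyOfWindowCovarianceG` (helper G of
`stub_stressIsotropyOfWindowCovariance`): the "always" form of a modulus of continuity of a bounded cut-off** — the
inequality through which the density cut-off `g(σ³ρ_r)` is frozen at its window value. [folklore] -/
theorem stub_stressIsotropyOfWindowCovarianceG : ∀ {g : ℝ → ℝ} {Gb κ lam : ℝ}, (∀ b, 0 ≤ b → |g b| ≤ Gb) → 0 ≤ κ → 0 < lam → (∀ b b', 0 ≤ b → 0 ≤ b' → |b - b'| < lam → |g b - g b'| ≤ κ) → ∀ {b b' : ℝ}, 0 ≤ b → 0 ≤ b' → |g b - g b'| ≤ κ + 2 * Gb / lam * |b - b'| :=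
  fun hGb hκ hlam hmod _ _ hb hb' => abs_sub_le_modulus_always hGb hκ hlam hmod hb hb'

end Summit.AtomisticToContinuum.HydrodynamicLimit.Theorems.ParityBandClosureWindowToCone

end
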